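import Summits.AnomalousDissipation.AnomalousDissipation.Theorems.FloorCertificateEnsembleCeiling.Negative.LaminarPreimage
import Literature.Analysis.FunctionSpaces.TorusPlanarLift
import Literature.Analysis.FunctionSpaces.TorusInverseLaplacian
import Literature.Analysis.FunctionSpaces.TorusFluidGlueProofs

/-!
# `TaylorCertificates.FloorCertificateEnsembleCeiling` (stmt-AnomalousDissipation-14086) — negative side X:
# smooth UNIDIRECTIONAL forces `(0, 0, g(x₁,x₂))` are not witnesses (first instance of the abstract Marchioro barrier)

cdisprove seat `refuter-cdisprove-stmt-AnomalousDissipation-14086-g3-0` (generation 3, 2026-08-16).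

`EnsembleCeiling/Negative/OrthogonalClassFat` excludes unidirectional forces that are finite trigonometric
polynomials. Here the profile is an arbitrary smooth function of two variables: for `G : T² → ℝ` smooth, the
`2½`-dimensional field `U = (0, 0, G(x₁,x₂))` (`Torus.twoHalf 0 G`) is smooth, solenoidal and a classical steady
Euler flow (`(U·∇)U = G ∂₃G e₃ = 0`, `Torus.convect_twoHalf`), hence weakly Euler-steady
(`unidirectional_eulerSteady`), and `Negative/LaminarPreimage` applies: the force `−ΔU = (0, 0, −ΔG(x₁,x₂))`
carries the laminar fat family `U/ν`, so the `∀ ν`-body of `X` is false at it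
(`xBody_false_unidirectional`). Every smooth mean-zero `g : T² → ℝ` is `−ΔG` for the smooth mean-zero
`G = −Δ⁻¹g` (`Torus.laplacian_invLaplacian`), so this covers ALL smooth unidirectional forces `g(x₁,x₂) e₃`
(`xBody_false_unidirectional'`, stated with `g` and its inverse Laplacian). Def-free; nothing here asserts a
Theses statement.
-/

noncomputable section

set_option linter.dupNamespace false

open MeasureTheory UnitAddTorus Filter Topology
open scoped InnerProductSpace ENNReal

namespace Summit.AnomalousDissipation.AnomalousDissipation.Theorems.FloorCertificateEnsembleCeiling.Negative

open Literature.Analysis.FunctionSpaces Literature.Analysis.FunctionSpaces.Torus Literature.Analysis.FluidPDE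
open Summit.AnomalousDissipation.AnomalousDissipation.Theses.TaylorCertificates

/-- The zero planar field is smooth. -/
theorem isSmooth_zero_planar : IsSmooth (0 : UnitAddTorus (Fin 2) → EuclideanSpace ℝ (Fin 2)) :=
  isSmooth_const (0 : EuclideanSpace ℝ (Fin 2))

/-- The zero planar field is divergence free. -/
theorem isDivFree_zero_planar : IsDivFree (0 : UnitAddTorus (Fin 2) → EuclideanSpace ℝ (Fin 2)) := by
  intro x
  have h : ∀ j : Fin 2,
      Torus.partialDeriv j (fun y : UnitAddTorus (Fin 2) => ((0 : UnitAddTorus (Fin 2) → EuclideanSpace ℝ (Fin 2)) y) j) x = 0 := by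
    intro j
    simp [Torus.partialDeriv, Torus.lineDeriv]
  simp only [divergence, h, Finset.sum_const_zero]

/-- **The unidirectional profile `U = (0,0,G(x₁,x₂))` is a smooth solenoidal weakly Euler-steady field**:
`(U·∇)U = 0` pointwise (`convect_twoHalf` with zero planar part), hence `∫ (U⊗U):∇w = −∫ ⟪(U·∇)U, w⟫ = 0`. -/
theorem unidirectional_eulerSteady {G : UnitAddTorus (Fin 2) → ℝ} (hG : IsSmooth G) :
    IsSmooth (twoHalf 0 G) ∧ IsDivFree (twoHalf 0 G) ∧
      ∀ w : UnitAddTorus (Fin 3) → EuclideanSpace ℝ (Fin 3), IsSmooth w → IsDivFree w → HasZeroMean w →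
        ∫ x, ⟪Torus.fderiv w x (twoHalf 0 G x), twoHalf 0 G x⟫_ℝ = 0 := by
  have hUs : IsSmooth (twoHalf 0 G) := isSmooth_zero_planar.twoHalf hG
  have hUd : IsDivFree (twoHalf 0 G) := isDivFree_zero_planar.twoHalf G
  have hconv : Torus.convect (twoHalf 0 G) (twoHalf 0 G) = 0 := by
    rw [convect_twoHalf (isSmooth_zero_planar.isContDiff (by simp)) (hG.isContDiff (by simp))]
    funext x
    have h1 : Torus.convect (0 : UnitAddTorus (Fin 2) → EuclideanSpace ℝ (Fin 2))
        (0 : UnitAddTorus (Fin 2) → EuclideanSpace ℝ (Fin 2)) = 0 := by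
      funext y
      simp [Torus.convect]
    rw [h1]
    simp only [twoHalf, Pi.zero_apply, inner_zero_left]
    rw [← Prod.zero_eq_mk, map_zero]
  refine ⟨hUs, hUd, fun w hw hdw _ => ?_⟩
  have hibp : ∫ x, ⟪Torus.fderiv w x (twoHalf 0 G x), twoHalf 0 G x⟫_ℝ =
      -∫ x, ⟪Torus.convect (twoHalf 0 G) (twoHalf 0 G) x, w x⟫_ℝ := by
    change ∫ x, ⟪Torus.convect (twoHalf 0 G) w x, twoHalf 0 G x⟫_ℝ = _
    rw [Torus.integral_inner_convect_eq_neg hUs hUd hw hUs]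
    congr 1
    exact integral_congr_ae (ae_of_all _ fun x => real_inner_comm _ _)
  rw [hibp, hconv]
  simp

/-- **Smooth unidirectional forces are not witnesses of `X`.** For `G : T² → ℝ` smooth with `∫ G = 0` and
`G ≠ 0` in `L²`, the `∀ ν`-body of `FloorCertificateEnsembleCeiling` is FALSE at the force
`f = −Δ(0,0,G(x₁,x₂)) = (0, 0, −ΔG(x₁,x₂))`: the laminar states `(0,0,G)/ν` are a fat steady family. -/
theorem xBody_false_unidirectional {G : UnitAddTorus (Fin 2) → ℝ} (hG : IsSmooth G) (hGm : ∫ y, G y = 0)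
    (hG0 : 0 < ∫ y, G y ^ 2) :
    ¬ ∃ (ε₀ E ν₀ : ℝ), 0 < ε₀ ∧ 0 < ν₀ ∧ ∀ ν : ℝ, 0 < ν → ν < ν₀ →
      (∃ (Φ₁ : Torus.CylindricalTest (Fin 3)) (θ₁ : ℝ), θ₁ ≤ 0 ∧ ∀ u : Torus.energySpace (Fin 3),
        Torus.eGradNormSq ((u : Lp (EuclideanSpace ℝ (Fin 3)) 2 (volume : Measure (UnitAddTorus (Fin 3)))) : UnitAddTorus (Fin 3) → EuclideanSpace ℝ (Fin 3)) ≠ ⊤ →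
        ‖u‖ ^ 2 ≤ 16 * (∫ x, ‖(fun x => -Torus.laplacian (twoHalf 0 G) x) x‖ ^ 2) / ν ^ 2 →
        ε₀ ≤ ν * (Torus.eGradNormSq ((u : Lp (EuclideanSpace ℝ (Fin 3)) 2 (volume : Measure (UnitAddTorus (Fin 3)))) : UnitAddTorus (Fin 3) → EuclideanSpace ℝ (Fin 3))).toReal +
          Torus.nsGeneratorPairing ν (fun x => -Torus.laplacian (twoHalf 0 G) x) u (Φ₁.grad u) +
          2 * θ₁ * (Torus.pairing (u : Lp (EuclideanSpace ℝ (Fin 3)) 2 (volume : Measure (UnitAddTorus (Fin 3)))) (fun x => -Torus.laplacian (twoHalf 0 G) x) -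
            ν * (Torus.eGradNormSq ((u : Lp (EuclideanSpace ℝ (Fin 3)) 2 (volume : Measure (UnitAddTorus (Fin 3)))) : UnitAddTorus (Fin 3) → EuclideanSpace ℝ (Fin 3))).toReal)) ∧
      (∀ μ : Measure (Torus.energySpace (Fin 3)), Torus.IsStationaryStatisticalSolution ν (fun x => -Torus.laplacian (twoHalf 0 G) x) μ →
        Integrable (fun v : Torus.energySpace (Fin 3) => ‖v‖ ^ 2) μ → Torus.ensembleEnergy μ ≤ E) := by
  obtain ⟨hUs, hUd, hI⟩ := unidirectional_eulerSteady hG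
  have hUz : HasZeroMean (twoHalf 0 G) := by
    unfold HasZeroMean
    set φ : UnitAddTorus (Fin 2) → EuclideanSpace ℝ (Fin 2) × ℝ := fun y => ((0 : EuclideanSpace ℝ (Fin 2)), G y) with hφ
    have hφi : Integrable φ volume := (integrable_const _).prodMk hG.integrable
    have hb : AEStronglyMeasurable (fun y => planarEmbed (φ y)) volume :=
      (planarEmbed.continuous.comp_aestronglyMeasurable hφi.aestronglyMeasurable)
    have h := integral_comp_planarProj hb
    have hint : ∫ y, φ y = 0 := by
      rw [hφ, integral_pair (integrable_const _) hG.integrable, hGm]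
      simp
    calc ∫ x, twoHalf 0 G x = ∫ x, (fun y => planarEmbed (φ y)) (planarProj x) := rfl
      _ = ∫ y, planarEmbed (φ y) := h
      _ = planarEmbed (∫ y, φ y) := planarEmbed.integral_comp_comm hφi
      _ = 0 := by rw [hint, map_zero]
  have hU0 : 0 < ∫ x, ‖twoHalf 0 G x‖ ^ 2 := by
    have h1 : (fun x => ‖twoHalf (0 : UnitAddTorus (Fin 2) → EuclideanSpace ℝ (Fin 2)) G x‖ ^ 2) =
        fun x => (fun y => G y ^ 2) (planarProj x) := by
      funext x
      rw [norm_sq_twoHalf]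
      simp
    rw [h1, integral_comp_planarProj (b := fun y => G y ^ 2) ((hG.continuous.pow 2).aestronglyMeasurable)]
    exact hG0
  exact xBody_false_of_eulerSteady_laplacianPreimage hUs hUd hUz hI hU0


/-- **The same with the force given**: `−Δ(0, 0, −Δ⁻¹g) = (0, 0, g)` for smooth mean-zero `g : T² → ℝ`. -/
theorem neg_laplacian_twoHalf_neg_invLaplacian {g : UnitAddTorus (Fin 2) → ℝ} (hg : IsSmooth g)
    (hgm : ∫ y, g y = 0) :
    (fun x => -Torus.laplacian (twoHalf 0 (fun y => -invLaplacian g y)) x) = twoHalf 0 g := by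
  have hG : IsSmooth (fun y => -invLaplacian g y) := (isSmooth_invLaplacian hg).neg
  have hL0 : Torus.laplacian (0 : UnitAddTorus (Fin 2) → EuclideanSpace ℝ (Fin 2)) = 0 := by
    have h := laplacian_iterate_zero (d := Fin 2) (F := EuclideanSpace ℝ (Fin 2)) 1
    rwa [Function.iterate_one] at h
  have hLG : Torus.laplacian (fun y => -invLaplacian g y) = fun y => -g y := by
    funext y
    have h1 : (fun y => -invLaplacian g y) = -invLaplacian g := rfl
    rw [h1, laplacian_neg_apply (isSmooth_invLaplacian hg), laplacian_invLaplacian hg, hgm, sub_zero]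
  funext x
  rw [laplacian_twoHalf isSmooth_zero_planar hG, hL0, hLG]
  simp only [twoHalf]
  rw [← map_neg]
  congr 1
  ext <;> simp

/-- `g ≠ 0` in `L²` forces `Δ⁻¹g ≠ 0` in `L²` (for smooth mean-zero `g`: `g = Δ(Δ⁻¹g)`). -/
theorem integral_sq_invLaplacian_pos {g : UnitAddTorus (Fin 2) → ℝ} (hg : IsSmooth g) (hgm : ∫ y, g y = 0)
    (hg0 : 0 < ∫ y, g y ^ 2) : 0 < ∫ y, (invLaplacian g y) ^ 2 := by
  have hG : IsSmooth (invLaplacian g) := isSmooth_invLaplacian hg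
  have hnn : 0 ≤ ∫ y, (invLaplacian g y) ^ 2 := integral_nonneg fun y => by positivity
  refine lt_of_le_of_ne hnn fun h0 => ?_
  have hint : Integrable (fun y => (invLaplacian g y) ^ 2) volume := (hG.continuous.pow 2).integrable_of_hasCompactSupport
    (HasCompactSupport.of_compactSpace _)
  have hae : (fun y => (invLaplacian g y) ^ 2) =ᵐ[volume] 0 :=
    (integral_eq_zero_iff_of_nonneg (fun y => by positivity) hint).1 h0.symm
  have hG0 : invLaplacian g = 0 := by
    have hae' : invLaplacian g =ᵐ[volume] (0 : UnitAddTorus (Fin 2) → ℝ) := by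
      filter_upwards [hae] with y hy
      have : invLaplacian g y ^ 2 = 0 := hy
      exact pow_eq_zero_iff two_ne_zero |>.1 this
    exact (Continuous.ae_eq_iff_eq volume hG.continuous continuous_const).1 hae'
  have hg' : g = 0 := by
    funext y
    have h1 := laplacian_invLaplacian hg y
    rw [hgm, sub_zero, hG0] at h1
    have hL0 : Torus.laplacian (0 : UnitAddTorus (Fin 2) → ℝ) = 0 := by
      have h := laplacian_iterate_zero (d := Fin 2) (F := ℝ) 1
      rwa [Function.iterate_one] at h
    rw [hL0] at h1
    simpa using h1.symm
  rw [hg'] at hg0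
  simp at hg0

/-- **Every smooth mean-zero unidirectional force `(0, 0, g(x₁,x₂))`, `g ≠ 0` in `L²`, fails the `∀ ν`-body of
`X`** (hence is not a witness of `FloorCertificateEnsembleCeiling`). -/
theorem xBody_false_unidirectional' {g : UnitAddTorus (Fin 2) → ℝ} (hg : IsSmooth g) (hgm : ∫ y, g y = 0)
    (hg0 : 0 < ∫ y, g y ^ 2) :
    ¬ ∃ (ε₀ E ν₀ : ℝ), 0 < ε₀ ∧ 0 < ν₀ ∧ ∀ ν : ℝ, 0 < ν → ν < ν₀ →
      (∃ (Φ₁ : Torus.CylindricalTest (Fin 3)) (θ₁ : ℝ), θ₁ ≤ 0 ∧ ∀ u : Torus.energySpace (Fin 3),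
        Torus.eGradNormSq ((u : Lp (EuclideanSpace ℝ (Fin 3)) 2 (volume : Measure (UnitAddTorus (Fin 3)))) : UnitAddTorus (Fin 3) → EuclideanSpace ℝ (Fin 3)) ≠ ⊤ →
        ‖u‖ ^ 2 ≤ 16 * (∫ x, ‖twoHalf 0 g x‖ ^ 2) / ν ^ 2 →
        ε₀ ≤ ν * (Torus.eGradNormSq ((u : Lp (EuclideanSpace ℝ (Fin 3)) 2 (volume : Measure (UnitAddTorus (Fin 3)))) : UnitAddTorus (Fin 3) → EuclideanSpace ℝ (Fin 3))).toReal +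
          Torus.nsGeneratorPairing ν (twoHalf 0 g) u (Φ₁.grad u) +
          2 * θ₁ * (Torus.pairing (u : Lp (EuclideanSpace ℝ (Fin 3)) 2 (volume : Measure (UnitAddTorus (Fin 3)))) (twoHalf 0 g) -
            ν * (Torus.eGradNormSq ((u : Lp (EuclideanSpace ℝ (Fin 3)) 2 (volume : Measure (UnitAddTorus (Fin 3)))) : UnitAddTorus (Fin 3) → EuclideanSpace ℝ (Fin 3))).toReal)) ∧
      (∀ μ : Measure (Torus.energySpace (Fin 3)), Torus.IsStationaryStatisticalSolution ν (twoHalf 0 g) μ →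
        Integrable (fun v : Torus.energySpace (Fin 3) => ‖v‖ ^ 2) μ → Torus.ensembleEnergy μ ≤ E) := by
  have hG : IsSmooth (fun y => -invLaplacian g y) := (isSmooth_invLaplacian hg).neg
  have hGm : ∫ y, (fun y => -invLaplacian g y) y = 0 := by
    simp only [integral_neg, integral_invLaplacian hg, neg_zero]
  have hG0 : 0 < ∫ y, (fun y => -invLaplacian g y) y ^ 2 := by
    simpa using integral_sq_invLaplacian_pos hg hgm hg0
  have h := xBody_false_unidirectional hG hGm hG0
  rwa [neg_laplacian_twoHalf_neg_invLaplacian hg hgm] at h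

end Summit.AnomalousDissipation.AnomalousDissipation.Theorems.FloorCertificateEnsembleCeiling.Negative

end
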